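import Summits.Ventures.PercRepro.ProfileGapMonoThresholdNullityFourAll

/-!
# PercRepro — THE TOP THRESHOLD OF THE CO-RANK-`4` FAMILY REDUCES TO SIMPLE COLOOP-FREE MATROIDS AT EVERY
NULLITY BOUND (p5, gen 33; `proofs/P5-GM1.md` §45(e))

The strong induction of `thresholdIneq_four_top_of_nullity_le_four` with the nullity bound `4` replaced by an
arbitrary `k`: if `(I_{ρ(E)−1})` at co-rank `4` holds on every SIMPLE COLOOP-FREE matroid of nullity `≤ k` and rank
`≥ 5`, then it holds on every finite matroid of nullity `≤ k` and rank `≥ 4` — loops (deleted at the same threshold),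
coloops (rank and threshold drop together) and parallel elements (the parallel-pair reduction through the co-rank-`3`
family of `N ∖ z ／ z'`, `thresholdIneq_three_all`) never raise the nullity.  So the open case of the co-rank-`4` top
threshold at nullity `≥ 5` is exactly its simple coloop-free case (`thresholdIneq_four_top_of_simple_coloopFree`);
`thresholdIneq_four_top_of_nullity_le_four'` recovers the nullity-`≤ 4` theorem from the three simple theorems.
Nothing open is asserted.
-/

open scoped Matroid

namespace PercRepro.Cogirth

open Finset ThmH Skew Shadow Profile

variable {α : Type} [DecidableEq α]

section Reduction

/-- **THE CO-RANK-`4` TOP THRESHOLD REDUCES TO SIMPLE COLOOP-FREE MATROIDS AT EVERY NULLITY BOUND `k`**: from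
`ThresholdIneq N 4 (ρ(E) − 1)` on every simple coloop-free `N` with `#E ≤ ρ(E) + k` and `ρ(E) ≥ 5`, the same on every
finite matroid with `#E ≤ ρ(E) + k` and `ρ(E) ≥ 4` (strong induction on `#E`: loop / coloop / parallel-pair deletion). -/
theorem thresholdIneq_four_top_of_simple_coloopFree (k : ℕ)
    (hsimple : ∀ (N : Matroid α) [N.Finite], (∀ x ∈ gr N, ∀ y ∈ gr N, x ≠ y → rk N {x, y} = 2) →
      (∀ z ∈ gr N, rk N ((gr N).erase z) = rk N (gr N)) → (gr N).card ≤ rk N (gr N) + k →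
      5 ≤ rk N (gr N) → ThresholdIneq N 4 (rk N (gr N) - 1))
    (N : Matroid α) [N.Finite] (hn : (gr N).card ≤ rk N (gr N) + k) (hR : 4 ≤ rk N (gr N)) :
    ThresholdIneq N 4 (rk N (gr N) - 1) := by
  suffices H : ∀ n, ∀ (N : Matroid α) [N.Finite], (gr N).card = n →
      (gr N).card ≤ rk N (gr N) + k → 4 ≤ rk N (gr N) → ThresholdIneq N 4 (rk N (gr N) - 1) from
    H _ N rfl hn hR
  intro n
  induction n using Nat.strong_induction_on with
  | _ n ih =>
  intro N _ hn hnu hR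
  -- rank exactly `4`: the threshold `3 = q − 1` is the vacuous `(I_4)`
  rcases Nat.lt_or_ge (rk N (gr N)) 5 with hR4 | hR5
  · have h4 : rk N (gr N) = 4 := by omega
    have h : ThresholdIneq N 4 4 := thresholdIneq_of_rk_le (by omega)
    have h' : ThresholdIneq N 4 (4 - 1) := (thresholdIneq_pred_iff (by norm_num)).2 h
    rw [h4]
    exact h'
  -- a loop: deleted at the same threshold, the rank unchanged
  by_cases hloop : ∃ ℓ ∈ gr N, rk N {ℓ} = 0
  · obtain ⟨ℓ, hℓ, h0⟩ := hloop
    have hpos : 0 < (gr N).card := card_pos.2 ⟨ℓ, hℓ⟩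
    have hrk : rk (N ＼ ({ℓ} : Set α)) (gr (N ＼ ({ℓ} : Set α))) = rk N (gr N) := by
      rw [gr_delete', rk_delete (Subset.refl _)]
      have h := rk_insert_of_loop hℓ h0 (erase_subset ℓ (gr N))
      rw [insert_erase hℓ] at h
      exact h.symm
    have hcard : (gr (N ＼ ({ℓ} : Set α))).card = (gr N).card - 1 := by
      rw [gr_delete', card_erase_of_mem hℓ]
    have h := ih _ (by omega) (N ＼ ({ℓ} : Set α)) rfl (by omega) (by omega)
    rw [hrk] at h
    exact thresholdIneq_top_of_loop hℓ h0 h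
  push Not at hloop
  have hone : ∀ x ∈ gr N, rk N {x} = 1 := by
    intro x hx
    have hle : rk N {x} ≤ ({x} : Finset α).card := rk_le_card' _
    rw [card_singleton] at hle
    have := hloop x hx
    omega
  -- a coloop: the rank and the threshold drop together
  by_cases hcol : ∃ z ∈ gr N, rk N ((gr N).erase z) + 1 = rk N (gr N)
  · obtain ⟨z, hz, hzc⟩ := hcol
    have hpos : 0 < (gr N).card := card_pos.2 ⟨z, hz⟩
    have hrk := rk_gr_delete_of_coloop hzc
    have hcard : (gr (N ＼ ({z} : Set α))).card = (gr N).card - 1 := by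
      rw [gr_delete', card_erase_of_mem hz]
    exact thresholdIneq_top_of_coloop hz hzc (by norm_num) (by omega)
      (ih _ (by omega) (N ＼ ({z} : Set α)) rfl (by omega) (by omega))
  push Not at hcol
  have hcf : ∀ z ∈ gr N, rk N ((gr N).erase z) = rk N (gr N) := by
    intro z hz
    have h := hcol z hz
    have := rk_le_rk_erase_add_one (M := N) (Subset.refl _) hz
    have := rk_mono' (M := N) (erase_subset z (gr N))
    omega
  -- a parallel pair: the parallel-pair reduction with the co-rank-`3` family of `N ∖ z ／ z'`
  by_cases hpar : ∃ z ∈ gr N, ∃ z' ∈ gr N, z ≠ z' ∧ rk N {z, z'} = 1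
  · obtain ⟨z, hz, z', hz', hzz', h1⟩ := hpar
    have hpos : 0 < (gr N).card := card_pos.2 ⟨z, hz⟩
    have hdel : ThresholdIneq (N ＼ ({z} : Set α) ／ ({z'} : Set α)) (4 - 1) (rk N (gr N) - 1 - 1) :=
      thresholdIneq_three_all _ (by omega)
    have hrk : rk (N ＼ ({z} : Set α)) (gr (N ＼ ({z} : Set α))) = rk N (gr N) := by
      rw [gr_delete', rk_delete (Subset.refl _)]
      exact hcf z hz
    have hcard : (gr (N ＼ ({z} : Set α))).card = (gr N).card - 1 := by
      rw [gr_delete', card_erase_of_mem hz]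
    have h := ih _ (by omega) (N ＼ ({z} : Set α)) rfl (by omega) (by omega)
    rw [hrk] at h
    exact thresholdIneq_of_delMonoT
      (delMonoT_of_parallel hz hz' hzz' (hone z hz) (hone z' hz') h1 (by norm_num) (by omega) hdel) h
  push Not at hpar
  have hpair : ∀ x ∈ gr N, ∀ y ∈ gr N, x ≠ y → rk N {x, y} = 2 := by
    intro x hx y hy hxy
    have hne1 := hpar x hx y hy hxy
    have hle : rk N {x, y} ≤ ({x, y} : Finset α).card := rk_le_card' _
    rw [card_pair hxy] at hle
    have hmono : rk N {x} ≤ rk N {x, y} := rk_mono' (singleton_subset_iff.2 (mem_insert_self _ _))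
    have := hone x hx
    omega
  -- simple, loopless, coloop-free, rank `≥ 5`: the hypothesis
  exact hsimple N hpair hcf hnu hR5

/-- **The nullity-`≤ 4` theorem from the reduction**: the three simple coloop-free theorems (nullity `≤ 2` vacuous,
`3`, `4`) through `thresholdIneq_four_top_of_simple_coloopFree` — a second proof of
`thresholdIneq_four_top_of_nullity_le_four`. -/
theorem thresholdIneq_four_top_of_nullity_le_four' (N : Matroid α) [N.Finite]
    (hn : (gr N).card ≤ rk N (gr N) + 4) (hR : 4 ≤ rk N (gr N)) :
    ThresholdIneq N 4 (rk N (gr N) - 1) := by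
  refine thresholdIneq_four_top_of_simple_coloopFree 4 ?_ N hn hR
  intro N _ hpair hcf hnu hR5
  rcases Nat.lt_or_ge (gr N).card (rk N (gr N) + 3) with hnu2 | hnu3
  · exact thresholdIneq_four_top_of_nullity_le_two (by omega)
  rcases Nat.lt_or_ge (gr N).card (rk N (gr N) + 4) with hnu3' | hnu4
  · exact thresholdIneq_four_top_of_nullity_three hcf (by omega) (by omega)
  · exact thresholdIneq_four_top_of_nullity_four hpair hcf (by omega) hR5

end Reduction

end PercRepro.Cogirth
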